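import Summits.QuantumFields.YangMills.Theorems.BalabanUVNodesK0TransportThirdMoment

/-!
# K0⁷ ∕ NODE O lens-2 «flow-gronwall-ttel» — PART C: the hypothesis class «Ward (T0)∕(T1) + m₂-free + absolutely summable THIRD moments» IS STABLE under the by-value
# transport `K ↦ Lc⁸ · dressedEntry (wStep Lc j) K (Lc • ·)` at EVERY level, so PART B's exact law `M3 ↦ Lc⁻¹·M3` ITERATES along the cocycle (`M3(K_n) = Lc^{−n}·M3(K_0)`)

Cell `pub-ymgap`, width seat `pub-ymgap-dag-n07-w3` (g18; N07 [B11] ∕ K0⁷–K1 junction; helper strictly BELOW the |β|-box stub of K0⁷ stmt-QuantumFields-20541).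
`--kind proof --supports stmt-QuantumFields-20541 --as helper`, COUNT-NEUTRAL.  NEW leaf; theorems only — 0 `def`, 0 `sorry`.  Imports PART B (hence PART A, `Beta.HessianTelescopingKKT`).

WHAT.  PART B (`…K0TransportThirdMoment.thirdMoment_transport_wStep`) proves the ONE-STEP law: for `K` with (T0), (T1), (T2 = 0) and `Summable ((1+|y|₁³)·|K c e y|)`, the transported kernel
`K' a b z := Lc⁸ · dressedEntry (wStep Lc j) K (Lc • z) a b` has third-moment tensor EXACTLY `Lc⁻¹ · M3(K)`.  To ITERATE (lens-2's cocycle `transportIter Lc j n`) one needs the four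
hypotheses again for `K'`: §1 the cubic summability of `K'` (the triple family with the integer weight `1 + |t+x−u|₁³` is summable by PART A's cubic engine — `1 + s³ ≤ 9(1+a³)(1+b³)(1+c³)` for
`s ≤ a+b+c` — regroups to the coarse point, and decimation `z ↦ Lc•z` only lowers the weight); §2 ★★ `wardFree₃_transport_wStep`: (T0)∕(T1) of `K'` by the tree's `hasSum_dressedEntry_zero ∕
_first` (the `EntryHyps` of the pair `(wStep Lc j, K)` hold by `constReproSum_wStep`∕`linReproSum_wStep`∕`absMoment₂_wStep` and `K`'s data), (T2 = 0) of `K'` by `hasSum_transport_m2Tensor`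
(the marginal tensor is transported unchanged, here `0`), cubic summability by §1.  Hence along the cocycle every iterate stays in the class and `M3(K_{n+1}) = Lc⁻¹·M3(K_n)` at each step
(§3 `thirdMoment_transport_wStep_of_class`, the one-step law restated on the class) — the `Lc⁻¹` channel of CRIT-1 CUT-1 S1 is an exact geometric mode `Lc^{−n}` of lens-2's P-α transport
on every Ward + m₂-free kernel with `M3 ≠ 0`; in particular no admissible `(ρ, C)` of P-α can have `ρ < Lc⁻¹` unless the class is cut down to `M3 = 0` (e.g. DIAGONAL colour pairs under
the parity (5.8), `…K0TransportParity`).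

HONEST FRAMING (binding).  [folklore] bookkeeping of absolutely convergent lattice sums; hypothesis shapes only; no kernel of the record is shown to be in the class; P-α (a NORM
contraction) is NOT proved or refuted here; nothing of Bałaban asserted or discharged; K0⁷ NOT closed; NODE O NOT inhabited; N07 NOT discharged; COUNT 8∕28 · K 1∕4 UNMOVED; R4 = the
conditional finite-𝕋⁴ rung `BalabanLadder.UV` only; NOT continuum ∕ ℝ⁴ ∕ OS; the Yang–Mills mass gap (Clay) is NOT proved by any of this.
-/

noncomputable section

namespace Summit.QuantumFields.YangMills.Theorems.K0TransportThirdMomentStable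

open Finset Filter Topology
open Literature.MathematicalPhysics.QuantumFieldTheory.Balaban1983to89
open Literature.MathematicalPhysics.QuantumFieldTheory.Balaban1983to89.Beta
open B12Sec2to5 (l1 l1_nonneg abs_coord_le_l1)
open DecimatedMomentLimit (l1_add_le)
open DecimatedMomentSummable
open DressedMomentNormalisation
open ExpKernelCalculus (l1_natSmul)
open OneStepKernelFamily (l1_neg_eq)
open HessianTelescopingKKT (wStep constReproSum_wStep linReproSum_wStep absMoment₂_wStep hasSum_transport_m2Tensor hasSum_dressedEntry_zero
  hasSum_dressedEntry_first)
open Summit.QuantumFields.YangMills.Theorems.K0TransportThirdMomentScalar (summable_term_of_bound₃ absMoment₂_of_absMoment₃)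
open Summit.QuantumFields.YangMills.Theorems.K0TransportThirdMoment (absMoment₃_wStep thirdMoment_transport_wStep)

variable {d : ℕ}

/-! ## §1. Absolutely summable THIRD moments are stable under two-sided dressing and decimation -/

/-- `|t + x − u|₁ ≤ |u|₁ + |t|₁ + |x|₁`. [folklore] -/
private theorem l1_add_sub_le (u t x : Fin d → ℤ) : l1 (t + x - u) ≤ l1 u + l1 t + l1 x := by
  have h1 : l1 (t + x - u) ≤ l1 (t + x) + l1 (-u) := by
    rw [sub_eq_add_neg]; exact l1_add_le _ _
  have h2 := l1_add_le t x
  rw [l1_neg_eq] at h1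
  linarith

/-- For `0 ≤ s ≤ a + b + c` with `a, b, c ≥ 0`: `1 + s³ ≤ 9·(1+a³)(1+b³)(1+c³)`. [folklore] -/
private theorem one_add_cube_le_nine_mul {a b c s : ℝ} (ha : 0 ≤ a) (hb : 0 ≤ b) (hc : 0 ≤ c) (hs0 : 0 ≤ s) (hs : s ≤ a + b + c) :
    1 + s ^ 3 ≤ 9 * ((1 + a ^ 3) * ((1 + b ^ 3) * (1 + c ^ 3))) := by
  have hs3 : s ^ 3 ≤ (a + b + c) ^ 3 := pow_le_pow_left₀ hs0 hs 3
  -- (a+b+c)³ ≤ 9(a³+b³+c³) for nonnegative reals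
  have hpm : (a + b + c) ^ 3 ≤ 9 * (a ^ 3 + b ^ 3 + c ^ 3) := by
    nlinarith [sq_nonneg (a - b), sq_nonneg (b - c), sq_nonneg (a - c), mul_nonneg ha hb, mul_nonneg hb hc, mul_nonneg ha hc,
      mul_nonneg (mul_nonneg ha hb) hc, mul_nonneg (add_nonneg ha hb) (sq_nonneg (a - b)),
      mul_nonneg (add_nonneg hb hc) (sq_nonneg (b - c)), mul_nonneg (add_nonneg ha hc) (sq_nonneg (a - c))]
  have h3 : 0 ≤ a ^ 3 := pow_nonneg ha 3
  have h3b : 0 ≤ b ^ 3 := pow_nonneg hb 3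
  have h3c : 0 ≤ c ^ 3 := pow_nonneg hc 3
  nlinarith [mul_nonneg h3 h3b, mul_nonneg h3b h3c, mul_nonneg h3 h3c, mul_nonneg (mul_nonneg h3 h3b) h3c]

/-- The integer weight `1 + (Σ_μ |y_μ|)³` casts to `1 + |y|₁³`. [folklore] -/
private theorem cast_wt3 (y : Fin d → ℤ) : (((1 + (∑ μ, |y μ|) ^ 3 : ℤ)) : ℝ) = 1 + l1 y ^ 3 := by
  unfold l1
  push_cast
  rfl

/-- **THE DRESSED SUM OF THREE PATTERNS WITH ABSOLUTELY SUMMABLE THIRD MOMENTS HAS AN ABSOLUTELY SUMMABLE THIRD MOMENT.** [folklore] -/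
theorem absMoment₃_dressedSum {w T w' : (Fin d → ℤ) → ℝ} (hw : Summable (fun y => (1 + l1 y ^ 3) * |w y|))
    (hT : Summable (fun y => (1 + l1 y ^ 3) * |T y|)) (hw' : Summable (fun y => (1 + l1 y ^ 3) * |w' y|)) :
    Summable (fun y => (1 + l1 y ^ 3) * |dressedSum w T w' y|) := by
  have hχ : ∀ z : Fin d → ℤ, |(((fun _ => (1 : ℤ)) z : ℤ) : ℝ)| ≤ 1 := fun _ => by rw [Int.cast_one, abs_one]
  have hS : Summable (term (fun _ => (1 : ℤ)) w T w' (fun u t x => 1 + (∑ μ, |(t + x - u) μ|) ^ 3)) := by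
    refine summable_term_of_bound₃ hχ hw hT hw' (B := 9) (fun u t x => ?_)
    rw [cast_wt3, abs_of_nonneg (by have := l1_nonneg (t + x - u); positivity)]
    exact one_add_cube_le_nine_mul (l1_nonneg u) (l1_nonneg t) (l1_nonneg x) (l1_nonneg _) (l1_add_sub_le u t x)
  have hH := hasSum_coarse (fun _ => (1 : ℤ)) w T w' (fun y => 1 + (∑ μ, |y μ|) ^ 3) hS.hasSum
    (summable_dressed_fibre (absMoment₂_of_absMoment₃ hw) (absMoment₂_of_absMoment₃ hT) (absMoment₂_of_absMoment₃ hw'))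
  have hsum : Summable (fun y => (((1 + (∑ μ, |y μ|) ^ 3 : ℤ)) : ℝ) * dressedSum w T w' y) := by
    refine hH.summable.congr fun y => ?_
    rw [one_mul, zsmul_eq_mul]
  refine hsum.abs.congr fun y => ?_
  rw [abs_mul, cast_wt3, abs_of_nonneg (by have := l1_nonneg y; positivity)]

/-- … hence so does every entry of the dressed matrix kernel. [folklore] -/
theorem absMoment₃_dressedEntry {D : ℕ} {w T : EKer D} (hw : ∀ κ l, Summable (fun y => (1 + l1 y ^ 3) * |w κ l y|))
    (hT : ∀ c e, Summable (fun y => (1 + l1 y ^ 3) * |T c e y|)) (a b : Fin D) :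
    Summable (fun y => (1 + l1 y ^ 3) * |dressedEntry w T y a b|) := by
  have hsum : Summable (fun y => ∑ c, ∑ e, (1 + l1 y ^ 3) * |dressedSum (w c a) (T c e) (w e b) y|) :=
    summable_sum fun c _ => summable_sum fun e _ => absMoment₃_dressedSum (hw c a) (hT c e) (hw e b)
  refine hsum.of_nonneg_of_le (fun y => mul_nonneg (by have := l1_nonneg y; positivity) (abs_nonneg _)) fun y => ?_
  unfold dressedEntry
  have h1 : |∑ c, ∑ e, dressedSum (w c a) (T c e) (w e b) y| ≤ ∑ c, ∑ e, |dressedSum (w c a) (T c e) (w e b) y| :=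
    (Finset.abs_sum_le_sum_abs _ _).trans (Finset.sum_le_sum fun c _ => Finset.abs_sum_le_sum_abs _ _)
  calc (1 + l1 y ^ 3) * |∑ c, ∑ e, dressedSum (w c a) (T c e) (w e b) y|
      ≤ (1 + l1 y ^ 3) * ∑ c, ∑ e, |dressedSum (w c a) (T c e) (w e b) y| :=
        mul_le_mul_of_nonneg_left h1 (by have := l1_nonneg y; positivity)
    _ = ∑ c, ∑ e, (1 + l1 y ^ 3) * |dressedSum (w c a) (T c e) (w e b) y| := by simp only [Finset.mul_sum]

/-- **DECIMATION only LOWERS the cubic weight**: `Summable ((1+|y|₁³)|f y|) → Summable ((1+|z|₁³)|f (N•z)|)` for `N ≠ 0`. [folklore] -/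
theorem absMoment₃_comp_zsmul {N : ℕ} (hN : N ≠ 0) {f : (Fin d → ℤ) → ℝ} (hf : Summable (fun y => (1 + l1 y ^ 3) * |f y|)) :
    Summable (fun z : Fin d → ℤ => (1 + l1 z ^ 3) * |f ((N : ℤ) • z)|) := by
  have hinj : Function.Injective (fun z : Fin d → ℤ => (N : ℤ) • z) := by
    intro z z' h
    have hN' : (N : ℤ) ≠ 0 := by exact_mod_cast hN
    funext i
    have hi := congrFun h i
    simp only [Pi.smul_apply, smul_eq_mul] at hi
    exact mul_left_cancel₀ hN' hi
  have hF : Summable (fun z : Fin d → ℤ => (1 + l1 ((N : ℤ) • z) ^ 3) * |f ((N : ℤ) • z)|) := hf.comp_injective hinj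
  have hN1 : (1 : ℝ) ≤ N := by exact_mod_cast Nat.one_le_iff_ne_zero.mpr hN
  refine hF.of_nonneg_of_le (fun z => mul_nonneg (by have := l1_nonneg z; positivity) (abs_nonneg _)) fun z => ?_
  have hl : l1 z ≤ l1 ((N : ℤ) • z) := by
    rw [l1_natSmul]
    nlinarith [l1_nonneg z]
  have hl3 : l1 z ^ 3 ≤ l1 ((N : ℤ) • z) ^ 3 := pow_le_pow_left₀ (l1_nonneg z) hl 3
  exact mul_le_mul_of_nonneg_right (by linarith) (abs_nonneg _)

/-- **CUBIC SUMMABILITY OF THE TRANSPORTED KERNEL** `z ↦ Lc⁸ · dressedEntry (wStep Lc j) K (Lc • z) a b`, at every level `j`, from the cubic summability of `K` alone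
(`absMoment₃_wStep` for the weight). [folklore] -/
theorem absMoment₃_transport_wStep {Lc : ℕ} [NeZero Lc] (j : ℕ) (K : EKer 4) (hK3 : ∀ c e, Summable (fun y => (1 + l1 y ^ 3) * |K c e y|)) (a b : Fin 4) :
    Summable (fun z : Fin 4 → ℤ => (1 + l1 z ^ 3) * |(Lc : ℝ) ^ 8 * dressedEntry (wStep Lc j) K ((Lc : ℤ) • z) a b|) := by
  have h := (absMoment₃_comp_zsmul (NeZero.ne Lc)
    (absMoment₃_dressedEntry (w := wStep Lc j) (T := K) (fun κ l => absMoment₃_wStep (Lc := Lc) j κ l) hK3 a b)).mul_left (|(Lc : ℝ) ^ 8|)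
  refine h.congr fun z => ?_
  rw [abs_mul]
  ring

/-! ## §2. The class «(T0) ∧ (T1) ∧ (T2 = 0) ∧ cubic» is preserved by the transport at every level -/

/-- The `EntryHyps` of the pair `(wStep Lc j, K)` from `K`'s Ward data and cubic summability (weight side: `constReproSum_wStep`, `linReproSum_wStep`, `absMoment₂_wStep`). [folklore] -/
theorem entryHyps_wStep_of_ward₃ {Lc : ℕ} [NeZero Lc] (j : ℕ) (K : EKer 4) (hK3 : ∀ c e, Summable (fun y => (1 + l1 y ^ 3) * |K c e y|))
    (hT0 : ∀ c e, HasSum (K c e) 0) (hT1 : ∀ c e (i : Fin 4), HasSum (fun t => t i • K c e t) 0) :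
    EntryHyps Lc (wStep Lc j) K where
  pos := Nat.pos_of_ne_zero (NeZero.ne Lc)
  const := fun κ l => constReproSum_wStep j κ l
  lin := fun κ l => linReproSum_wStep j κ l
  absW := fun κ l => absMoment₂_wStep j κ l
  absT := fun c e => absMoment₂_of_absMoment₃ (hK3 c e)
  T0 := hT0
  T1 := hT1

/-- **★★ THE CLASS IS TRANSPORT-STABLE**: if `K` has (T0), (T1), (T2 = 0) and absolutely summable third moments, so does `K' a b z := Lc⁸ · dressedEntry (wStep Lc j) K (Lc • z) a b`,
at EVERY level `j` — (T0)∕(T1) by the tree's `hasSum_dressedEntry_zero ∕ _first`, (T2 = 0) because the second-moment tensor is transported UNCHANGED (`hasSum_transport_m2Tensor`),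
cubic summability by §1. [folklore] -/
theorem wardFree₃_transport_wStep {Lc : ℕ} [NeZero Lc] (j : ℕ) (K : EKer 4) (hK3 : ∀ c e, Summable (fun y => (1 + l1 y ^ 3) * |K c e y|))
    (hT0 : ∀ c e, HasSum (K c e) 0) (hT1 : ∀ c e (i : Fin 4), HasSum (fun t => t i • K c e t) 0)
    (hT2 : ∀ c e (i i' : Fin 4), HasSum (fun t => (t i * t i') • K c e t) 0) :
    letI K' : EKer 4 := fun a b z => (Lc : ℝ) ^ 8 * dressedEntry (wStep Lc j) K ((Lc : ℤ) • z) a b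
    (∀ a b, Summable (fun y => (1 + l1 y ^ 3) * |K' a b y|)) ∧ (∀ a b, HasSum (K' a b) 0) ∧
      (∀ a b (i : Fin 4), HasSum (fun z => z i • K' a b z) 0) ∧ (∀ a b (i i' : Fin 4), HasSum (fun z => (z i * z i') • K' a b z) 0) := by
  have hE := entryHyps_wStep_of_ward₃ (Lc := Lc) j K hK3 hT0 hT1
  refine ⟨fun a b => absMoment₃_transport_wStep (Lc := Lc) j K hK3 a b, fun a b => ?_, fun a b i => ?_, fun a b i i' => ?_⟩
  · have h0 := (hasSum_dressedEntry_zero hE a b).mul_left ((Lc : ℝ) ^ 8)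
    rw [mul_zero] at h0
    exact h0
  · have h1 := (hasSum_dressedEntry_first hE a b i).mul_left ((Lc : ℝ) ^ 8)
    rw [mul_zero] at h1
    refine h1.congr_fun fun z => ?_
    simp only [zsmul_eq_mul]
    ring
  · have h2 := hasSum_transport_m2Tensor hE i i' a b
    have hm : m2Tensor K i i' a b = 0 := (hT2 a b i i').tsum_eq
    rw [hm] at h2
    exact h2

/-! ## §3. The one-step law restated on the class (so it iterates: `M3(K_{n+1}) = Lc⁻¹ · M3(K_n)` along any cocycle of such steps) -/

/-- **THE `Lc⁻¹` LAW ON THE STABLE CLASS**: for `K` in the class, the transported kernel `K'` is again in the class (§2) AND `M3(K') = Lc⁻¹ · M3(K)` entrywise (PART B); by induction along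
lens-2's cocycle `transportIter Lc j n` (levels `j, j+1, …`), `M3(K_n) = Lc^{−n} · M3(K_0)` — an exact geometric mode of ratio `Lc⁻¹` inside the Ward + m₂-free subspace. [folklore] -/
theorem thirdMoment_transport_wStep_of_class {Lc : ℕ} [NeZero Lc] (j : ℕ) (K : EKer 4) (hK3 : ∀ c e, Summable (fun y => (1 + l1 y ^ 3) * |K c e y|))
    (hT0 : ∀ c e, HasSum (K c e) 0) (hT1 : ∀ c e (i : Fin 4), HasSum (fun t => t i • K c e t) 0)
    (hT2 : ∀ c e (i i' : Fin 4), HasSum (fun t => (t i * t i') • K c e t) 0) (κ lam μ a b : Fin 4) :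
    ∑' z : Fin 4 → ℤ, (z κ * z lam * z μ) • ((fun a' b' z' => (Lc : ℝ) ^ 8 * dressedEntry (wStep Lc j) K ((Lc : ℤ) • z') a' b') a b z)
      = ((Lc : ℝ))⁻¹ * ∑' t : Fin 4 → ℤ, (t κ * t lam * t μ) • K a b t := by
  have h := (thirdMoment_transport_wStep (Lc := Lc) j K hK3 hT0 hT1 hT2 κ lam μ a b).tsum_eq
  rw [← h]
  refine tsum_congr fun z => ?_
  rw [zsmul_eq_mul, Int.cast_mul, Int.cast_mul]

end Summit.QuantumFields.YangMills.Theorems.K0TransportThirdMomentStable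

end
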